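import Summits.CriticalPhenomena.PercolationContinuityZ3.Theorems.Transplant.GrigorchukPowerBallMatrices
import Summits.CriticalPhenomena.PercolationContinuityZ3.Theorems.Transplant.GrigorchukPowerGrowth
import Summits.CriticalPhenomena.PercolationContinuityZ3.Theorems.Transplant.GrigorchukPowerSmallParam
import Literature.Barriers.CriticalPhenomena.SubexponentialGrowthZdProofs
import HarnessLib

/-!
# W4 — `TraceMonotonicity (Cay(𝔊^k))` UNCONDITIONALLY (item E4.3, file c): the W4 stub `stub_traceMonotonicity` discharged

Proof file (`--supports stmt-CriticalPhenomena-4575 --as helper`), lane `prim-bschramm`, seat `prim-bschramm-gen-1` gen 12 (GEN pen); item E4.3 (lead g29 #9800, design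
shape p3 g42 #9829, statements p5-g34 #9831), FILE c of three, over FILE a «GrigorchukPowerLazyKernel», FILE b «GrigorchukPowerBallMatrices», DEFS-A
«GrigorchukPowerNcHaraSladeDefs» (p704571), «GrigorchukPowerGrowth» (p686057: `gkCay_not_hasExponentialGrowth`), «GrigorchukPowerSmallParam» (`gkCay_isRegularOfDegree`).
builds on p205010 (kernel theorem, internal audit signed; external expert review pending) — nothing here uses p205010.  Def-free; no instance, no notation, no sorry,
no `@[conjecture]`; nothing about `θ(p_c)`.

THE THEOREM.  **`traceMonotonicity_gkCay (k : ℕ) : TraceMonotonicity (gkCay k)`** — DEFS-A's hypothesis shape P3 holds for every `Cay(𝔊^k; std)`, `k ≥ 0`: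
for every `C`, the operator infrared bound `OIRB_C` gives `∇_v(p) ≤ C³ · G^L_3(v)` for all `p < p_c(v)`.  It is the special case of
**`traceMonotonicity_of_transitive`**: the same for every connected, vertex-transitive, `d`-regular, locally finite graph NOT of exponential growth.

THE ARGUMENT (finite shadow + ball truncation + Følner, p3 #9829).  Fix `C = ofReal c` (the cases `C = ⊤`, `G^L_3(v) = ⊤` are trivial and `C = 0` contradicts `OIRB` at `δ_v`),
`p < p_c(v)`, and radii `S ≤ R`; `B = B_R(v)`.  FILE b gives `0 ⪯ T_B ⪯ c·G_B` hence `tr T_B³ ≤ c³ tr G_B³` (p686689).  Diagonals: `(G_B³)(x,x) ≤ G^L_3(x) = G^L_3(v)`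
(transitivity), so `tr G_B³ ≤ |B_R| G^L_3(v)`; and `(T_B³)(x,x) ≥ ∇^{(S)}(x) = ∇^{(S)}(v)` for `x ∈ B_{R−S}(v)` (`B_S(x) ⊆ B_R(v)`), where `∇^{(S)}(x) = Σ_{y,z∈B_S(x)} τττ`.
Hence `∇^{(S)}(v)·|B_{R−S}(v)| ≤ c³ G^L_3(v)·|B_R(v)|` for all `R ≥ S` (`localTriangle_mul_card_le`).  A graph not of exponential growth has `inf_R |B_R|/|B_{R−S}| = 1`
(else `|B_{jS}| ≥ q^j`), so `∇^{(S)}(v) ≤ c³ G^L_3(v)` (`le_of_forall_mul_card_ball_le`); finally `∇_v(p) = sup_S ∇^{(S)}(v)` (`triangle_le_of_forall_ball`).  Summability of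
`n ↦ p^L_n(x,y)` (needed by FILE b) follows from `G^L_3(v) < ∞`, transitivity and FILE a's `p^L_n(x,y) ≤ (p^L_n(x,x)+p^L_n(y,y))/2`.
[cite: HeydenreichVanDerHofstad2017, §1.2 (infrared bound), §4.1 (triangle condition), §5.2 (random-walk diagrams)] [cite: HornJohnson2013, Cor. 7.7.4]
[cite: Grigorchuk1984, Thm. (subexponential growth; direct powers)] [cite: AntunovicVeselic2007, §2 (Aut(G)-invariance)]
-/

noncomputable section

namespace Summit.CriticalPhenomena.PercolationContinuityZ3.Theorems.Transplant

namespace Grigorchuk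

namespace NcHaraSlade

open SimpleGraph Finset MeasureTheory Filter Literature.Probability.Percolation Literature.Barriers.CriticalPhenomena
open scoped ENNReal Topology

variable {V : Type} [DecidableEq V] (G : SimpleGraph V) [G.LocallyFinite]

/-! ## §1 Automorphism invariance of the walk kernel, the two-point function and the diagrams -/

omit [DecidableEq V] in
/-- Automorphisms map neighbourhoods to neighbourhoods (finset form, for `Finset.sum_map`; degrees: Mathlib's `SimpleGraph.Iso.degree_eq`). [folklore] -/
theorem neighborFinset_iso (γ : G ≃g G) (x : V) : G.neighborFinset (γ x) = (G.neighborFinset x).map γ.toEquiv.toEmbedding := by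
  ext z
  simp only [mem_neighborFinset, Finset.mem_map, Equiv.coe_toEmbedding, RelIso.coe_fn_toEquiv]
  constructor
  · intro h
    refine ⟨γ.symm z, ?_, γ.apply_symm_apply z⟩
    have h' := γ.symm.map_adj_iff.2 h
    rwa [γ.symm_apply_apply] at h'
  · rintro ⟨w, hw, rfl⟩
    exact γ.map_adj_iff.2 hw

omit [DecidableEq V] in
/-- **`p^L_n(γ x, γ y) = p^L_n(x, y)`** for `γ ∈ Aut(G)`. [cite: Woess2000, §1.B (transition operators commute with automorphisms)] -/
theorem lazyStep_iso (γ : G ≃g G) (n : ℕ) (x y : V) : lazyStep G n (γ x) (γ y) = lazyStep G n x y := by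
  induction n generalizing x with
  | zero =>
    rw [lazyStep_zero, lazyStep_zero]
    by_cases hxy : x = y
    · rw [if_pos hxy, if_pos (by rw [hxy])]
    · rw [if_neg hxy, if_neg fun h => hxy (γ.injective h)]
  | succ n ih =>
    rw [lazyStep_succ, lazyStep_succ, neighborFinset_iso G γ x, Finset.sum_map, SimpleGraph.Iso.degree_eq γ x, ih x]
    simp only [Equiv.coe_toEmbedding, RelIso.coe_fn_toEquiv, ih]

omit [DecidableEq V] [G.LocallyFinite] in
/-- **`τ_p(γ x, γ y) = τ_p(x, y)`** for `γ ∈ Aut(G)` («SubexponentialGrowthZdProofs» `real_openConn_iso`). [cite: AntunovicVeselic2007, §2] -/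
theorem conn_iso (γ : G ≃g G) (p : unitInterval) (x y : V) : conn G p (γ x) (γ y) = conn G p x y :=
  real_openConn_iso γ p x y

omit [DecidableEq V] in
/-- `G^L_q(γ v) = G^L_q(v)`. [folklore] -/
theorem rwPolygon_iso (γ : G ≃g G) (q : ℕ) (v : V) : rwPolygon q G (γ v) = rwPolygon q G v := by
  unfold rwPolygon
  simp only [lazyStep_iso]

/-- The ball-restricted triangle diagram `∇^{(S)}(x) = Σ_{y,z∈B_S(x)} τ(x,y)τ(y,z)τ(z,x)` is `Aut(G)`-invariant. [cite: AntunovicVeselic2007, §2] -/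
theorem localTriangle_iso (γ : G ≃g G) (p : unitInterval) (x : V) (S : ℕ) :
    ∑ y ∈ DCTQ.ball G (γ x) S, ∑ z ∈ DCTQ.ball G (γ x) S, conn G p (γ x) y * conn G p y z * conn G p z (γ x) =
      ∑ y ∈ DCTQ.ball G x S, ∑ z ∈ DCTQ.ball G x S, conn G p x y * conn G p y z * conn G p z x := by
  rw [← DCTQ.map_ball γ x S, Finset.sum_map]
  refine Finset.sum_congr rfl fun y _ => ?_
  rw [Finset.sum_map]
  refine Finset.sum_congr rfl fun z _ => ?_
  simp only [Equiv.coe_toEmbedding, RelIso.coe_fn_toEquiv, conn_iso]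

/-! ## §2 Balls: the finset ball of «SharpnessQuasiTransitive» versus `graphBall` / `ballVolume` of «SubexponentialGrowthZd» -/

/-- `↑B(v, n) = graphBall G v n`. [folklore] -/
theorem coe_ball_eq_graphBall (v : V) (n : ℕ) : (↑(DCTQ.ball G v n) : Set V) = graphBall G v n := by
  ext y
  simp only [Finset.mem_coe, DCTQ.mem_ball_iff, graphBall, Set.mem_setOf_eq]

/-- `|B(v, n)| = #(DCTQ.ball G v n)`. [folklore] -/
theorem ballVolume_eq_card_ball (v : V) (n : ℕ) : ballVolume G v n = (DCTQ.ball G v n).card := by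
  rw [ballVolume, ← coe_ball_eq_graphBall, Set.ncard_coe_finset]

/-- `|B(γ v, n)| = |B(v, n)|`. [cite: AntunovicVeselic2007, §2] -/
theorem card_ball_iso (γ : G ≃g G) (v : V) (n : ℕ) : (DCTQ.ball G (γ v) n).card = (DCTQ.ball G v n).card := by
  rw [← DCTQ.map_ball γ v n, Finset.card_map]

/-! ## §3 The Følner step: no exponential growth forces `inf_R |B_R| / |B_{R−S}| = 1` -/

/-- **Ratio lemma.** On a vertex-transitive graph NOT of exponential growth: if `a·|B_{R−S}(v)| ≤ b·|B_R(v)|` for every `R ≥ S` (`b ≥ 0`), then `a ≤ b`.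
Otherwise `q = a/b > 1` and `|B_{jS}(v)| ≥ q^j` for all `j`, an exponential lower bound at every vertex (transitivity), contradicting the growth hypothesis.
[cite: Grigorchuk1984, Thm. (subexponential growth)] [cite: LyonsPeres2016, §6.1 (subexponential growth ⇒ Følner balls)] -/
theorem le_of_forall_mul_card_ball_le (htr : IsGraphTransitive G) (hgr : ¬ HasExponentialGrowth G) (v : V) (S : ℕ) {a b : ℝ} (hb : 0 ≤ b)
    (h : ∀ R : ℕ, S ≤ R → a * ((DCTQ.ball G v (R - S)).card : ℝ) ≤ b * ((DCTQ.ball G v R).card : ℝ)) : a ≤ b := by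
  by_contra hab
  rw [not_le] at hab
  have hcard0 : ((DCTQ.ball G v 0).card : ℝ) = 1 := by simp
  -- `b > 0`: at `R = S` the hypothesis reads `a ≤ b·|B_S|`
  have hb0 : 0 < b := by
    by_contra hb0
    rw [not_lt] at hb0
    have h0 := h S le_rfl
    rw [Nat.sub_self, hcard0, mul_one] at h0
    have : b * ((DCTQ.ball G v S).card : ℝ) ≤ 0 := mul_nonpos_of_nonpos_of_nonneg hb0 (Nat.cast_nonneg _)
    linarith
  set q : ℝ := a / b with hq
  have hq1 : 1 < q := (one_lt_div hb0).2 hab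
  -- geometric growth along the multiples of `S`
  have hgeom : ∀ j : ℕ, q ^ j ≤ ((DCTQ.ball G v (j * S)).card : ℝ) := by
    intro j
    induction j with
    | zero => simp
    | succ j ih =>
      have hR := h ((j + 1) * S) (by nlinarith)
      rw [show (j + 1) * S - S = j * S by rw [add_mul, one_mul, Nat.add_sub_cancel]] at hR
      have hstep : q * ((DCTQ.ball G v (j * S)).card : ℝ) ≤ ((DCTQ.ball G v ((j + 1) * S)).card : ℝ) := by
        rw [hq, div_mul_eq_mul_div, div_le_iff₀ hb0]
        linarith
      calc q ^ (j + 1) = q * q ^ j := pow_succ' q j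
        _ ≤ q * ((DCTQ.ball G v (j * S)).card : ℝ) := mul_le_mul_of_nonneg_left ih (by linarith)
        _ ≤ _ := hstep
  -- `S = 0` is absurd
  rcases Nat.eq_zero_or_pos S with rfl | hS
  · have h1 := hgeom 1
    rw [mul_zero, hcard0, pow_one] at h1
    linarith
  -- a growth constant `c > 1` with `c^(2S) ≤ q`
  obtain ⟨c, hc1, hcq⟩ : ∃ c : ℝ, 1 < c ∧ c ^ (2 * S) ≤ q := by
    have hcont : ContinuousAt (fun x : ℝ => x ^ (2 * S)) 1 := (continuous_pow (2 * S)).continuousAt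
    have hev : ∀ᶠ x : ℝ in 𝓝 1, x ^ (2 * S) < q := hcont.eventually (gt_mem_nhds (by simpa using hq1))
    obtain ⟨δ, hδ, hball⟩ := Metric.eventually_nhds_iff.1 hev
    refine ⟨1 + δ / 2, by linarith, (hball ?_).le⟩
    rw [Real.dist_eq, add_sub_cancel_left, abs_of_pos (by linarith)]
    linarith
  apply hgr
  intro x
  obtain ⟨γ, hγ⟩ := htr v x
  refine ⟨c, hc1, ?_⟩
  filter_upwards [Filter.eventually_ge_atTop (2 * S)] with n hn
  have hdiv : n ≤ 2 * S * (n / S) := by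
    have h1 := Nat.div_add_mod n S
    have h2 := Nat.mod_lt n hS
    rw [mul_assoc]
    set u := S * (n / S)
    omega
  calc c ^ n ≤ c ^ (2 * S * (n / S)) := pow_le_pow_right₀ hc1.le hdiv
    _ = (c ^ (2 * S)) ^ (n / S) := pow_mul c (2 * S) (n / S)
    _ ≤ q ^ (n / S) := pow_le_pow_left₀ (by positivity) hcq _
    _ ≤ ((DCTQ.ball G v (n / S * S)).card : ℝ) := hgeom (n / S)
    _ ≤ ((DCTQ.ball G v n).card : ℝ) := by exact_mod_cast Finset.card_le_card (DCTQ.ball_mono v (Nat.div_mul_le_self n S))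
    _ = (ballVolume G x n : ℝ) := by rw [ballVolume_eq_card_ball, ← hγ, card_ball_iso]

/-! ## §4 The triangle diagram is the supremum of its ball restrictions -/

omit [DecidableEq V] [G.LocallyFinite] in
/-- Nonnegativity of a triangle summand. -/
theorem conn_mul_mul_nonneg (p : unitInterval) (x y z : V) : 0 ≤ conn G p x y * conn G p y z * conn G p z x :=
  mul_nonneg (mul_nonneg (conn_nonneg G p x y) (conn_nonneg G p y z)) (conn_nonneg G p z x)

/-- **`∇_v(p) ≤ b` as soon as every ball restriction `ofReal ∇^{(S)}(v) ≤ b`** (connected graph: finite sets of pairs sit in some `B_S(v)²`; `ℝ≥0∞` sums are suprema of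
finite sums). [cite: HeydenreichVanDerHofstad2017, §4.1 (triangle diagram)] -/
theorem triangle_le_of_forall_ball (hconn : G.Connected) (v : V) (p : unitInterval) {b : ℝ≥0∞}
    (h : ∀ S : ℕ, ENNReal.ofReal (∑ x ∈ DCTQ.ball G v S, ∑ y ∈ DCTQ.ball G v S, conn G p v x * conn G p x y * conn G p y v) ≤ b) :
    triangle G v p ≤ b := by
  unfold triangle
  rw [← ENNReal.tsum_prod, ENNReal.tsum_eq_iSup_sum]
  refine iSup_le fun F => ?_
  obtain ⟨S, hS⟩ := DCTQ.exists_subset_ball hconn v (F.image Prod.fst ∪ F.image Prod.snd)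
  have hF : F ⊆ DCTQ.ball G v S ×ˢ DCTQ.ball G v S := by
    intro q hq
    rw [Finset.mem_product]
    exact ⟨hS (Finset.mem_union_left _ (Finset.mem_image_of_mem _ hq)), hS (Finset.mem_union_right _ (Finset.mem_image_of_mem _ hq))⟩
  calc ∑ q ∈ F, ENNReal.ofReal (conn G p v q.1 * conn G p q.1 q.2 * conn G p q.2 v)
      ≤ ∑ q ∈ DCTQ.ball G v S ×ˢ DCTQ.ball G v S, ENNReal.ofReal (conn G p v q.1 * conn G p q.1 q.2 * conn G p q.2 v) :=
        Finset.sum_le_sum_of_subset hF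
    _ = ENNReal.ofReal (∑ x ∈ DCTQ.ball G v S, ∑ y ∈ DCTQ.ball G v S, conn G p v x * conn G p x y * conn G p y v) := by
        rw [Finset.sum_product, ENNReal.ofReal_sum_of_nonneg fun x _ => Finset.sum_nonneg fun y _ => conn_mul_mul_nonneg G p v x y]
        exact Finset.sum_congr rfl fun x _ => (ENNReal.ofReal_sum_of_nonneg fun y _ => conn_mul_mul_nonneg G p v x y).symm
    _ ≤ b := h S

/-! ## §5 Summability of the walk kernel from `G^L_3(v) < ∞` -/

omit [DecidableEq V] in
/-- `G^L_3(v) ≠ 0` (the `N = 0` term is `1`). -/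
theorem rwPolygon_three_ne_zero (v : V) : rwPolygon 3 G v ≠ 0 := by
  rw [rwPolygon_three_eq]
  refine ne_of_gt (lt_of_lt_of_le ?_ (ENNReal.le_tsum 0))
  simp

/-- `G^L_3(x) < ∞ ⇒ Σ_n p^L_n(x, x) < ∞` (the binomial weights are `≥ 1`). [cite: Woess2000, §1.B] -/
theorem summable_lazyStep_self_of_rwPolygon_ne_top (x : V) (hfin : rwPolygon 3 G x ≠ ⊤) : Summable fun n => lazyStep G n x x := by
  have hle : ∑' N, ENNReal.ofReal (lazyStep G N x x) ≤ rwPolygon 3 G x := by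
    rw [rwPolygon_three_eq]
    refine ENNReal.tsum_le_tsum fun N => le_mul_of_one_le_left zero_le ?_
    exact_mod_cast Nat.succ_le_of_lt (Nat.choose_pos (by omega))
  have hne : ∑' N, ENNReal.ofReal (lazyStep G N x x) ≠ ⊤ := ne_top_of_le_ne_top hfin hle
  exact (ENNReal.summable_toReal hne).congr fun N => ENNReal.toReal_ofReal (lazyStep_nonneg G N x x)

/-- **On a transitive `d`-regular graph with `G^L_3(v) < ∞`, every `n ↦ p^L_n(x, y)` is summable** (`p^L_n(x,y) ≤ (p^L_n(x,x)+p^L_n(y,y))/2`, FILE a; `G^L_3(x) =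
G^L_3(v)` by transitivity). [cite: Woess2000, §1.B] -/
theorem summable_lazyStep_of_rwPolygon_ne_top {d : ℕ} (hG : G.IsRegularOfDegree d) (htr : IsGraphTransitive G) (v : V) (hfin : rwPolygon 3 G v ≠ ⊤)
    (x y : V) : Summable fun n => lazyStep G n x y := by
  have hdiag : ∀ z : V, Summable fun n => lazyStep G n z z := fun z => by
    obtain ⟨γ, hγ⟩ := htr v z
    refine summable_lazyStep_self_of_rwPolygon_ne_top G z ?_
    rwa [← hγ, rwPolygon_iso]
  refine Summable.of_nonneg_of_le (fun n => lazyStep_nonneg G n x y) (fun n => lazyStep_le_half_add G hG n x y) ?_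
  exact ((hdiag x).add (hdiag y)).div_const 2

/-! ## §6 The per-radius inequality `∇^{(S)}(v)·|B_{R−S}(v)| ≤ c³ G^L_3(v)·|B_R(v)|` -/

/-- **`∇^{(S)}(v) · |B_{R−S}(v)| ≤ c³ · G^L_3(v) · |B_R(v)|`** for `S ≤ R`, on a transitive `d`-regular graph under `OIRB_{ofReal c}` and `p < p_c(v)`, with
`G^L_3(v) < ∞`: the trace comparison `tr T_B³ ≤ c³ tr G_B³` of FILE b on `B = B_R(v)`, the diagonal bounds of FILE b, and `Aut(G)`-invariance.
[cite: HeydenreichVanDerHofstad2017, §1.2, §4.1, §5.2] [cite: HornJohnson2013, Cor. 7.7.4] -/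
theorem localTriangle_mul_card_le [Countable V] {d : ℕ} (hG : G.IsRegularOfDegree d) (htr : IsGraphTransitive G)
    (hsum : ∀ x y : V, Summable fun n => lazyStep G n x y) {c : ℝ} (hc : 0 ≤ c) (hO : OperatorIRBound G (ENNReal.ofReal c))
    {p : unitInterval} {v : V} (hp : (p : ℝ) < criticalProb G v) (hfin : rwPolygon 3 G v ≠ ⊤) {S R : ℕ} (hSR : S ≤ R) :
    (∑ y ∈ DCTQ.ball G v S, ∑ z ∈ DCTQ.ball G v S, conn G p v y * conn G p y z * conn G p z v) * ((DCTQ.ball G v (R - S)).card : ℝ) ≤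
      c ^ 3 * (rwPolygon 3 G v).toReal * ((DCTQ.ball G v R).card : ℝ) := by
  set B : Finset V := DCTQ.ball G v R with hB
  set T : Matrix ↥B ↥B ℝ := Matrix.of fun x y : ↥B => conn G p (x : V) (y : V) with hT
  set Gm : Matrix ↥B ↥B ℝ := Matrix.of fun x y : ↥B => ∑' n, lazyStep G n (x : V) (y : V) with hGm
  -- the triangle restricted to `B`, at `x`
  set h : V → ℝ := fun x => ∑ y ∈ B, ∑ z ∈ B, conn G p x y * conn G p y z * conn G p z x with hh
  have hRx : ∀ x : V, rwPolygon 3 G x = rwPolygon 3 G v := fun x => by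
    obtain ⟨γ, hγ⟩ := htr v x
    rw [← hγ, rwPolygon_iso]
  -- (1) `∇^{(S)}(v)·|B_{R−S}| = Σ_{x∈B_{R−S}} ∇^{(S)}(x)`
  have h1 : (∑ y ∈ DCTQ.ball G v S, ∑ z ∈ DCTQ.ball G v S, conn G p v y * conn G p y z * conn G p z v) * ((DCTQ.ball G v (R - S)).card : ℝ) =
      ∑ x ∈ DCTQ.ball G v (R - S), ∑ y ∈ DCTQ.ball G x S, ∑ z ∈ DCTQ.ball G x S, conn G p x y * conn G p y z * conn G p z x := by
    rw [mul_comm, ← nsmul_eq_mul, ← Finset.sum_const]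
    refine Finset.sum_congr rfl fun x _ => ?_
    obtain ⟨γ, hγ⟩ := htr v x
    rw [← hγ, localTriangle_iso]
  -- (2) `∇^{(S)}(x) ≤ h(x)` for `x ∈ B_{R−S}(v)` (`B_S(x) ⊆ B_R(v)`)
  have h2 : ∀ x ∈ DCTQ.ball G v (R - S),
      ∑ y ∈ DCTQ.ball G x S, ∑ z ∈ DCTQ.ball G x S, conn G p x y * conn G p y z * conn G p z x ≤ h x := by
    intro x hx
    have hsub : DCTQ.ball G x S ⊆ B := fun y hy => by
      have hy' := DCTQ.mem_ball_add hx hy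
      rwa [Nat.sub_add_cancel hSR] at hy'
    calc ∑ y ∈ DCTQ.ball G x S, ∑ z ∈ DCTQ.ball G x S, conn G p x y * conn G p y z * conn G p z x
        ≤ ∑ y ∈ DCTQ.ball G x S, ∑ z ∈ B, conn G p x y * conn G p y z * conn G p z x :=
          Finset.sum_le_sum fun y _ => Finset.sum_le_sum_of_subset_of_nonneg hsub fun z _ _ => conn_mul_mul_nonneg G p x y z
      _ ≤ h x := Finset.sum_le_sum_of_subset_of_nonneg hsub fun y _ _ => Finset.sum_nonneg fun z _ => conn_mul_mul_nonneg G p x y z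
  -- (3) `Σ_{x∈B_{R−S}} h(x) ≤ Σ_{x∈B} h(x) = tr T_B³`
  have h3 : ∑ x ∈ DCTQ.ball G v (R - S), h x ≤ ∑ x ∈ B, h x :=
    Finset.sum_le_sum_of_subset_of_nonneg (DCTQ.ball_mono v (Nat.sub_le R S)) fun x _ _ =>
      Finset.sum_nonneg fun y _ => Finset.sum_nonneg fun z _ => conn_mul_mul_nonneg G p x y z
  have h4 : (T ^ 3).trace = ∑ x ∈ B, h x := by
    unfold Matrix.trace
    simp only [Matrix.diag_apply, hT, connMatrix_pow_three_diag]
    exact Finset.sum_coe_sort B h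
  -- (4) the finite shadow, and the Green diagonal
  have h5 : (T ^ 3).trace ≤ c ^ 3 * (Gm ^ 3).trace := trace_connMatrix_pow_three_le G hG hsum hc hO hp B
  have h6 : (Gm ^ 3).trace ≤ ((DCTQ.ball G v R).card : ℝ) * (rwPolygon 3 G v).toReal := by
    unfold Matrix.trace
    calc ∑ i : ↥B, Matrix.diag (Gm ^ 3) i ≤ ∑ i : ↥B, (rwPolygon 3 G (i : V)).toReal :=
          Finset.sum_le_sum fun i _ => by
            rw [Matrix.diag_apply, hGm]
            exact greenMatrix_pow_three_diag_le G hsum B i (by rw [hRx]; exact hfin)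
      _ = ∑ _i : ↥B, (rwPolygon 3 G v).toReal := Finset.sum_congr rfl fun i _ => by rw [hRx]
      _ = ((DCTQ.ball G v R).card : ℝ) * (rwPolygon 3 G v).toReal := by
          rw [Finset.sum_const, Finset.card_univ, Fintype.card_coe, nsmul_eq_mul]
  -- assemble
  calc (∑ y ∈ DCTQ.ball G v S, ∑ z ∈ DCTQ.ball G v S, conn G p v y * conn G p y z * conn G p z v) * ((DCTQ.ball G v (R - S)).card : ℝ)
      = ∑ x ∈ DCTQ.ball G v (R - S), ∑ y ∈ DCTQ.ball G x S, ∑ z ∈ DCTQ.ball G x S, conn G p x y * conn G p y z * conn G p z x := h1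
    _ ≤ ∑ x ∈ DCTQ.ball G v (R - S), h x := Finset.sum_le_sum h2
    _ ≤ ∑ x ∈ B, h x := h3
    _ = (T ^ 3).trace := h4.symm
    _ ≤ c ^ 3 * (Gm ^ 3).trace := h5
    _ ≤ c ^ 3 * (((DCTQ.ball G v R).card : ℝ) * (rwPolygon 3 G v).toReal) := mul_le_mul_of_nonneg_left h6 (pow_nonneg hc 3)
    _ = c ^ 3 * (rwPolygon 3 G v).toReal * ((DCTQ.ball G v R).card : ℝ) := by ring

/-! ## §7 Assembly -/

/-- **Trace monotonicity on transitive graphs of subexponential growth.**  For a connected, vertex-transitive, `d`-regular, locally finite graph NOT of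
exponential growth: `∀ C, OIRB_C(G) → ∀ v, ∀ p < p_c(v), ∇_v(p) ≤ C³ · G^L_3(v)` — DEFS-A's `TraceMonotonicity G`.  (`C = ⊤` and `G^L_3(v) = ⊤` are trivial,
`C = 0` contradicts `OIRB` at `δ_v`; otherwise §6 + §3 + §4.) [cite: HeydenreichVanDerHofstad2017, §1.2, §4.1, §5.2] [cite: HornJohnson2013, Cor. 7.7.4] -/
theorem traceMonotonicity_of_transitive {d : ℕ} (hG : G.IsRegularOfDegree d) (htr : IsGraphTransitive G) (hconn : G.Connected)
    (hgr : ¬ HasExponentialGrowth G) : TraceMonotonicity G := by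
  intro C hO v p hp
  haveI : Countable V := countable_of_connected_of_locallyFinite G hconn v
  -- `C ≠ 0`: the operator bound tested on `δ_v` (`τ(v,v) = 1`)
  have hC0 : C ≠ 0 := by
    intro hC
    have h := hO v p hp (Finsupp.single v 1)
    rw [hC, zero_mul, nonpos_iff_eq_zero, ENNReal.ofReal_eq_zero] at h
    unfold twoPointForm at h
    rw [Finsupp.support_single v one_ne_zero, Finset.sum_singleton, Finset.sum_singleton, Finsupp.single_eq_same, conn_self] at h
    norm_num at h
  have hR0 : rwPolygon 3 G v ≠ 0 := rwPolygon_three_ne_zero G v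
  by_cases hCtop : C = ⊤
  · rw [hCtop, ENNReal.top_pow (by norm_num), ENNReal.top_mul hR0]
    exact le_top
  by_cases hRtop : rwPolygon 3 G v = ⊤
  · rw [hRtop, ENNReal.mul_top (pow_ne_zero 3 hC0)]
    exact le_top
  -- main case: `C = ofReal c`, `G^L_3(v) < ∞`
  set c : ℝ := C.toReal with hc
  have hc0 : 0 ≤ c := ENNReal.toReal_nonneg
  have hCc : C = ENNReal.ofReal c := (ENNReal.ofReal_toReal hCtop).symm
  rw [hCc] at hO ⊢
  have hsum := summable_lazyStep_of_rwPolygon_ne_top G hG htr v hRtop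
  refine triangle_le_of_forall_ball G hconn v p fun S => ?_
  have hle : (∑ y ∈ DCTQ.ball G v S, ∑ z ∈ DCTQ.ball G v S, conn G p v y * conn G p y z * conn G p z v) ≤ c ^ 3 * (rwPolygon 3 G v).toReal :=
    le_of_forall_mul_card_ball_le G htr hgr v S (by positivity) fun R hSR => localTriangle_mul_card_le G hG htr hsum hc0 hO hp hRtop hSR
  calc ENNReal.ofReal (∑ y ∈ DCTQ.ball G v S, ∑ z ∈ DCTQ.ball G v S, conn G p v y * conn G p y z * conn G p z v)
      ≤ ENNReal.ofReal (c ^ 3 * (rwPolygon 3 G v).toReal) := ENNReal.ofReal_le_ofReal hle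
    _ = ENNReal.ofReal c ^ 3 * rwPolygon 3 G v := by
        rw [ENNReal.ofReal_mul (pow_nonneg hc0 3), ENNReal.ofReal_pow hc0, ENNReal.ofReal_toReal hRtop]

/-- **`Cay(𝔊^k; std)` is vertex-transitive** (left multiplications). [cite: BenjaminiSchramm1996, §2 (Cayley graphs are transitive)] -/
theorem gkCay_isGraphTransitive (k : ℕ) : IsGraphTransitive (gkCay k) := fun x y =>
  ⟨⟨Equiv.mulLeft (y * x⁻¹), mulCayley_adj_mul_iff_right⟩, show y * x⁻¹ * x = y from inv_mul_cancel_right y x⟩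

/-- **`TraceMonotonicity (Cay(𝔊^k; std))` for every `k` — the W4 stub `stub_traceMonotonicity` DISCHARGED, unconditionally**: `Cay(𝔊^k)` is connected,
vertex-transitive, `4k`-regular and not of exponential growth (p686057), so `traceMonotonicity_of_transitive` applies.
[cite: HeydenreichVanDerHofstad2017, §1.2, §4.1, §5.2] [cite: Grigorchuk1984, Thm. (subexponential growth; direct powers)] -/
theorem traceMonotonicity_gkCay (k : ℕ) : TraceMonotonicity (gkCay k) := by
  classical
  exact traceMonotonicity_of_transitive (gkCay k) (gkCay_isRegularOfDegree k) (gkCay_isGraphTransitive k) (gkCay_connected k)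
    (gkCay_not_hasExponentialGrowth k)

end NcHaraSlade

end Grigorchuk

end Summit.CriticalPhenomena.PercolationContinuityZ3.Theorems.Transplant

end
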